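import Mathlib
import Literature.MathematicalPhysics.QuantumFieldTheory.Balaban1983to89.B10Eq61PerSite

/-
Copyright: publication-cell `pub-balaban` (b2b), seat b2b-balaban-b13 gen 14.  Literature leaf — one-variable complex
analysis (the Schwarz–Cauchy estimate) and real bookkeeping only; every theorem is kernel-proved and tagged [folklore]
or [cite: …] (a LOCATED printed shape); the `def … : Prop` leaves are HYPOTHESIS SHAPES, consumed as hypotheses and
never asserted; NO new cited facts, NO summit vocabulary.
-/

/-!
# `Balaban1983to89.B13LogHalfRadius` — [Balaban1988RG2Cluster] p. 21 *"an absolute constant instead of E₀"*: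
# the B13 owner's bookkeeping of the LINE RADIUS behind reading (a) of cell GAPS G-B13-12a — X-dependent radii,
# no lower bound `ρ > 1`, and the exponent of (LM) that the word "absolute" costs (companion of `B13` Part G and of
# `B10Eq61PerSite` §3; unit b2b-balaban-b13-g14, answer to the b10 lineage's cross-read request)

T. Bałaban, *Renormalization group approach to lattice gauge field theories. II. Cluster expansions*, Commun. Math.
Phys. **116**, 1–22 (1988) [Balaban1988RG2Cluster] (cell paper B13; renders `1988-cmp116-rg-II-cluster-p020/p021-
x2.png`, journal page = PDF page, READ AS IMAGES for this module); T. Bałaban, *Renormalization group approach to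
lattice gauge field theories. I*, Commun. Math. Phys. **109**, 249–301 (1987) [Balaban1987RG1] (B12; render `1987-
cmp109-rg-I-small-field-p014-x2.png` = p. 262); T. Bałaban, *Propagators for lattice gauge theories in a background
field*, Commun. Math. Phys. **99**, 389–434 (1985) [Balaban1985BackgroundPropagators] (B9 = [13] of [I], [II]; renders
`1985-cmp99-background-propagators-p008/p009/p012-x2.png` = pp. 396, 397, 400); T. Bałaban, *Ultraviolet stability of
three-dimensional lattice pure gauge field theories*, Commun. Math. Phys. **102**, 255–275 (1985) [Balaban1985UV3]
(B10 = [16] of [II]; (28) p. 263 as quoted in the tree's `B10Eq61PerSite` §0).  Siblings (imported, not modified): the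
tree's `…B13` Part G (`LogHalfBound`, `VolBoundK1`, `Bound118`, `bound118_of_logHalfBound`, `Consts.R21`) and the b10
lineage's `…B10Eq61PerSite` (`diffAlong`, `LineInDomain`, `AnalyticAlong`, `norm_sub_le_two_div`,
`bound118_literal_of_analyticRadius`).

WHY THIS MODULE (cell GAPS G-B13-12a and its two UPDATE rows; the b10 lineage's cross-read request to the B13 owner).
`B13` Part G typed the log Z^{(k)} half of (I.1.18) as the leaf `LogHalfBound` (per-LM-cube constant `B`, rate `r`) and
recorded two readings of p. 21's *"absolute constant"*: (a) `B = A·θ·(LM)⁴` with a per-site smallness `θ`, absolute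
after the printed restriction R21 `(LM)⁴α₀ ≤ 1`; (b) `B = A·(LM)⁴`.  `B10Eq61PerSite` then DERIVED `θ = 2/ρ` from
analyticity along the complex line through `U_{k+1} = 1` and `U_{k+1}` (Schwarz lemma), `ρ` = (analyticity radius)/
(deviation), and in §3 booked `ρ = ε/α₀` with ONE radius `ε`, X-uniform and `> α₀`, leaving "is ε independent of
L, M?" as the residual.  Read against the printed definition of the evaluation space and the printed hypotheses of
[13], that residual has more structure, which this module books:
* the evaluation space `Uᶜ_{k+1}(X, α₀, α₁, γ₀)` ([Balaban1987RG1] (1.11)–(1.13)) has CURVATURE `α₀` but POTENTIAL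
  `O(1)LMBα₀` on cubes of size `O(1)LM`, and complex thickness `α₁` in potential units; the analyticity domain of
  [13] is a tube `U′U` around the real regular configurations with the POTENTIAL-type thresholds `Mα₀ ≤ a₀`
  ((3.35), Theorem 3.1) and `α₁ ≤ a₁` (Theorem 3.4), `a₀` *"dependent on d and L only"* — so the disc `|ζ| < ρ` along
  a line `ζ ↦ exp iζξ𝓐` is limited by potential / threshold ratios of the form `a/(O(1)·LM·B·α₀)`: neither
  L, M-independent nor `O(1)` — and, the line being ONE configuration on the whole dependence set of the term, the
  potential `𝓐` of a single gauge on that set grows with its diameter (the printed instance of this growth is (28) of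
  [16]: *"|B(c)| < 4L²|c₋ − y|g₀p(g₀)"*), i.e. with `1 + d_{k+1}(X)`: the radius is X-DEPENDENT, `ρ_X ≥ ρ₀/(1 + d_{k+1}(X))`,
  and NOT bounded below by 1;
* §§1–2 show that both features are harmless for the SHAPE: with no lower bound on the radius the Schwarz step still
  gives the factor `4/ρ_X` (crude branch `2K` when `ρ_X ≤ 2`), and a factor linear in `1 + d_{k+1}(X)` costs exactly one
  more unit of rate (`1 + d ≤ eᵈ`, as in `B13.bound118_of_logHalfBound`): (I.1.18) for the differenced half with
  constant `(4/ρ₀)·B·c₁` and rate `r − 2` (`bound118_diffAlong_var`);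
* §3 books what "absolute" then COSTS: the constant is `4K·A·c₁` as soon as `(LM)⁴ ≤ K·ρ₀`
  (`bound118_absolute_of_radius`); for a base radius of the located form `ρ₀ = a/(LM·B′·α₀)` this is the restriction
  `(LM)⁵·B′·α₀ ≤ K·a` — of the printed TYPE of R21 (p. 20: *"(LM)⁴α₀ … bounded by a constant independent of M, for
  example by 1"*) with exponent 5 instead of 4 (`radius_of_pow5`, `bound118_absolute_of_pow5`; NOT PRINTED; admissible
  in the order of constants, α₀ being fixed after L, M: [Balaban1987RG1] Theorem 3 *"The constants ε₀, ε₁, α₀, α₁ depend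
  on M"*), while the printed exponent 4 leaves the constant `4·(LM·B′/a)·A·c₁` — one power of LM short of absolute
  (`radius_of_R21`, `bound118_of_R21_radius`).
Nothing printed is asserted and nothing is decided about which radius print supplies: the module is the typed form of
the B13 owner's answer "reading (a) is reachable in the admissible order at the price of an unprinted exponent and one
more unit of decay rate; the printed R21 alone gives reading (b) improved from (LM)⁴ to (LM)¹" — modulo the leaves.

CITATION HEADER (lean-in-tree rule).  WHAT IS REPRODUCED, verbatim from the renders, in §0 below: [Balaban1988RG2Cluster]
p. 20 (R21) and p. 21 (the closing paragraph); [Balaban1987RG1] p. 262 ((i)–(ii), (1.11)–(1.13), and the sentence citing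
(3.35)–(3.38) [13]); [Balaban1985BackgroundPropagators] p. 396 ((3.35), the sentence after (3.36), (3.37)), p. 397
(Theorem 3.1, frame), p. 400 (the two sentences before Theorem 3.4, Theorem 3.4, the sentence after it);
[Balaban1985UV3] (28) p. 263 (from the tree's `B10Eq61PerSite` §0, render re-read there).

WHAT IS KERNEL-CERTIFIED (one-variable complex analysis and real arithmetic — no object of the papers is constructed):
* §1 [folklore] `norm_sub_le_four_div`: `f` holomorphic on `|ζ| < ρ` (ANY `ρ > 0`), `‖f‖ ≤ K` there and `‖f 1‖ ≤ K` ⇒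
  `‖f 1 − f 0‖ ≤ (4/ρ)·K` (Schwarz branch `2/ρ ≤ 4/ρ` for `ρ > 2`, crude branch `2K ≤ (4/ρ)K` for `ρ ≤ 2`).
* §2 leaves with an X-DEPENDENT radius `ρ : D.Dom → ℝ`: (L1ᵛ) `LineInDomainVar`, (L2ᵛ) `AnalyticAlongVar`, (L0)
  `EvalInDomain` (the evaluation point lies in the analyticity space — automatic when `ρ_X > 1`,
  `evalInDomain_of_lineInDomainVar`); the d-LINEAR per-cube shape `LogHalfBoundLin` (`B·(1 + d)·nX·e^{−rd}`) and its
  conversion `logHalfBound_of_lin` (rate `r − 1`); PROVED: `logHalfBoundLin_diffAlong` — (L0)+(L1ᵛ)+(L2ᵛ) with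
  `ρ_X ≥ ρ₀/(1 + d_{k+1}(X))` + the undifferenced `B13.LogHalfBound … B r` ⇒ the differenced family obeys
  `LogHalfBoundLin … ((4/ρ₀)·B) r`; `bound118_diffAlong_var` — with `B13.VolBoundK1 c₁`: `B13.Bound118 … ((4/ρ₀)·B·c₁)
  (r − 2)`.  Constant radius recovers the shape of `B10Eq61PerSite.logHalfBound_diffAlong` with `4/ρ` for `2/ρ` and no
  hypothesis `ρ > 1` (`logHalfBound_diffAlong_anyRadius`).
* §3 [folklore arithmetic + the cited shapes] `bound118_absolute_of_radius` (`(LM)⁴ ≤ K·ρ₀` ⇒ constant `4K·A·c₁`),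
  `radius_of_pow5` / `bound118_absolute_of_pow5` (base radius `a/(LM·B′·α₀)` and `(LM)⁵B′α₀ ≤ K·a` ⇒ absolute),
  `radius_of_R21` / `bound118_of_R21_radius` (printed `(LM)⁴α₀ ≤ 1` ⇒ constant `4(LM·B′/a)·A·c₁`), and the named
  unprinted restriction `Consts.R21pow p κ` (`(LM)ᵖα₀ ≤ κ`; `R21pow 4 1` = the first clause of the printed `Consts.R21`,
  `Consts.r21pow_four_of_R21`).
* §4 non-vacuity: the leaves of §2 and the undifferenced bound are jointly satisfiable by the NON-CONSTANT example
  family of `B10Eq61PerSite` §5 (`example`).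

HONEST SCOPE.  (i) Nothing of the series is asserted: (L0)–(L2ᵛ), `LogHalfBound`, `VolBoundK1` are hypotheses; the
module proves what they imply.  (ii) The DICTIONARY "base radius `ρ₀ = a/(LM·B′·α₀)`, growth `1 + d_{k+1}(X)`" is the
B13 owner's reading of the printed thresholds of [13] against the printed definition (1.11)–(1.13) of [I] — recorded in
the cell's GAPS (C-B13-30), NOT a theorem about the papers' objects: which radius the random-walk expansion of [16]
(63) actually enjoys on `Uᶜ_{k+1}(X, α₀, α₁, γ₀)` in d = 4 is printed nowhere (cell GAPS G-B13-12, G-IF-10, G-B10-06) and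
is not decided here; in particular the complex direction (threshold `a₁`, thickness `α₁ + |Im ζ|·|𝓐|`) and the
non-abelian correction to the curvature of `exp isξ𝓐` give further constraints of the same potential type, all of the
form "`ρ_X⁻¹ = O(LM·(1 + d)·α₀ + α₁)` with L-dependent O-constants", which the abstract hypothesis `ρ₀/(1 + d) ≤ ρ_X`
covers without choosing among them.  (iii) A holomorphic line through `1` and `𝐔` needs ONE small logarithm of `𝐔` on the
whole dependence set (a global gauge there); for dependence sets winding around the torus no curvature bound supplies
one — not addressed in print, not modelled here (the leaves are per-X hypotheses; an X without a line is an X where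
they fail).  (iv) NOT a proof of (I.1.18), of Theorem I.3, or of any estimate of the series; NOT summit progress.

## §0. The printed sentences (verbatim, read off the renders for this module)

[Balaban1988RG2Cluster] p. 20: *"We assume that (LM)⁴α₀, (LM)⁴α₁, (LM)⁴α₄, (LM)⁴γ₂ are bounded by a constant
independent of M, for example by 1. Then O(1)(LM)⁴α₅ + exp(−½(κ₁ − 1)) is bounded by an absolute constant."*
p. 21: *"The effective action in (I.1.6) is obtained by adding to the above action the expression [log Z^{(k)}(U_{k+1})
− log Z^{(k)}(1)]. For this expression we construct the representation (I.1.7) using the generalized random walk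
expansion for Z^{(k)}(U_{k+1}). The expansion was constructed in [16], see the formula (63) there, and the discussion
after it. We gather all terms in the expansions, localized in X, and we extend them to analytic functions of 𝐔, 𝐉. The
expression localized in X satisfies the bound (I.1.18) with κ replaced by δ₀M, and with an absolute constant instead of
E₀. We define ½E₀ as equal to this constant, and we take M sufficiently large, so that δ₀M ≥ κ."*
[Balaban1987RG1] p. 262: *"The space Uᶜ_j(X, α₀, α₁, γ₀) is a union of orbits [(𝐔, 𝐉)] determined by configurations 𝐔, 𝐉
satisfying the four conditions written below. (i) 𝐔 = U′U, U has values in the group G, |∂U − 1| < α₀ξ² on X, (1.11)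
for each cube □ ⊂ X of a size O(1)LM there exists a G-valued gauge transformation u defined on □ and such, that
U^u = exp iξA, |A|, |∇^ξA| < O(1)LMBα₀ on □, (1.12) with a sufficiently large constant B (it will be determined
later). (ii) U′ = exp iξA′, A′ has values in the algebra 𝔤ᶜ, |A′|, |∇^ξ_U A′| < α₁ on X. (1.13)"*; *"The first three
conditions (i)–(iii) in the above definition are rather simple and natural, the conditions of this form appeared many
times in the previous papers, e.g. see (3.35)–(3.38) [13]."*
[Balaban1985BackgroundPropagators] p. 396: *"for an arbitrary cube □ of the described above class, and for a
configuration U there exists a gauge transformation u on □ such that U^u = e^{iηA}, and if the index of □ is j, then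
|A| < O(1)Mα₀(L^jη)⁻¹, |∇^ηA| < O(1)Mα₀(L^jη)⁻² on □, where O(1)M is a size of □ in T_{L^{−j}}; (3.35)"*; *"The number
α₀ characterizes this class of configurations. We will need α₀ so small that O(1)Mα₀ is still a sufficiently small
number."*; *"We assume that they have the form U′U, where U has values in G and U′ = e^{iηA′}, A′ ∈ 𝔤ᶜ. For a given pair
of positive numbers α₀, α₁ we consider the class of these configurations satisfying: U satisfies the condition (3.35),
and |A′| < α₁(L^jη)⁻¹, |∇^η_U A′| < α₁(L^jη)⁻² on Ω_j, j = 0, …, k; (3.37)"*.  p. 397: *"Theorem 3.1. There exist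
positive constants M₁, δ₀, a₀, B₀ dependent on d and L only, a constant B₀(β) dependent on d, L and β, 0 ≤ β < 1
(B₀(β) → ∞ if β → 1), such that for M ≥ M₁ and for an arbitrary configuration U satisfying the regularity condition
(3.35) with Mα₀ ≤ a₀, the operator G′(U) (a = 1) satisfies the inequalities"* [(3.42)–(3.47)].  p. 400: *"Such a
neighbourhood is given by configurations U′U satisfying the condition (3.37), i.e. U′ = e^{iηA}, where A is a
sufficiently regular configuration with values in the complexified Lie algebra 𝔤ᶜ. The regularity is described by
the inequality (3.37). We will assume that α₁ is sufficiently small."*; *"Theorem 3.4. There exists a positive constant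
a₁ such that the operators G′(U), (Q′(U)G′²(U)Q′*(U))⁻¹, R(U), G(U) extend to configurations U′U for α₁ ≤ a₁ as
analytic functions of A. The extended operators satisfy all the inequalities of Theorems 3.1–3.3 correspondingly. In
fact we prove quantitative statements which are more precise, describing these analytic extensions as small
perturbations of the operators depending on U only."*
[Balaban1985UV3] p. 263 (28): *"|B(c)| < 4L²|c₋ − y|g₀p(g₀) < 8L²3R₁M₁r(g₀)g₀p(g₀)"*.
-/

noncomputable section

open Metric Set

namespace Literature.MathematicalPhysics.QuantumFieldTheory.Balaban1983to89.B13LogHalfRadius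

/-! ## §1. The one-variable core with NO lower bound on the radius [folklore] -/

section core

variable {F : Type*} [NormedAddCommGroup F] [NormedSpace ℂ F]

/-- **Schwarz–Cauchy estimate, any radius.**  `f` holomorphic on the disc `|ζ| < ρ`, `ρ > 0`, with `‖f‖ ≤ K` there,
and `‖f 1‖ ≤ K` (automatic when `ρ > 1`; a separate datum when the disc does not reach `ζ = 1`) ⇒
`‖f 1 − f 0‖ ≤ (4/ρ)·K`: for `ρ > 2` this is the Schwarz branch (`B10Eq61PerSite.norm_sub_le_two_div`, `2/ρ ≤ 4/ρ`),
for `ρ ≤ 2` the crude branch `‖f 1‖ + ‖f 0‖ ≤ 2K ≤ (4/ρ)K`.  The point: an X-dependent radius may be small for some X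
without breaking the SHAPE of the bound. [folklore] -/
theorem norm_sub_le_four_div {f : ℂ → F} {ρ K : ℝ} (hρ : 0 < ρ) (hf : DifferentiableOn ℂ f (ball 0 ρ))
    (hK : ∀ ζ ∈ ball (0 : ℂ) ρ, ‖f ζ‖ ≤ K) (h1 : ‖f 1‖ ≤ K) : ‖f 1 - f 0‖ ≤ 4 / ρ * K := by
  have hK0 : 0 ≤ K := le_trans (norm_nonneg _) h1
  by_cases h : 2 < ρ
  · have hρ1 : 1 < ρ := by linarith
    calc ‖f 1 - f 0‖ ≤ 2 / ρ * K := B10Eq61PerSite.norm_sub_le_two_div hρ1 hf hK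
      _ ≤ 4 / ρ * K :=
          mul_le_mul_of_nonneg_right (div_le_div_of_nonneg_right (by norm_num) hρ.le) hK0
  · rw [not_lt] at h
    have h0 : ‖f 0‖ ≤ K := hK 0 (mem_ball_self hρ)
    have h2 : (2 : ℝ) ≤ 4 / ρ := by
      rw [le_div_iff₀ hρ]; linarith
    calc ‖f 1 - f 0‖ ≤ ‖f 1‖ + ‖f 0‖ := norm_sub_le _ _
      _ ≤ K + K := add_le_add h1 h0
      _ = 2 * K := by ring
      _ ≤ 4 / ρ * K := mul_le_mul_of_nonneg_right h2 hK0

end core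

/-! ## §2. The leaves with an X-dependent radius, the d-linear per-cube shape, and what the subtraction costs -/

/-- The d-LINEAR per-cube shape: `‖E(X)‖ ≤ B · (1 + d_{k+1}(X)) · nX(X) · e^{−r d_{k+1}(X)}` on the spaces `sp X` — the
form a per-cube constant takes when the Schwarz radius shrinks like `(1 + d_{k+1}(X))⁻¹` (one gauge on the whole
dependence set; cf. the factor `|c₋ − y|` of [Balaban1985UV3] (28)).  Hypothesis shape; converts to `B13.LogHalfBound`
with rate `r − 1` (`logHalfBound_of_lin`). [cite: Balaban1988RG2Cluster, p.21 (closing paragraph)] -/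
def LogHalfBoundLin (D : LocDomainSys) {Φ : Type*} (sp : D.Dom → Set Φ) (E : D.Dom → Φ → ℂ) (nX : D.Dom → ℕ)
    (B r : ℝ) : Prop :=
  ∀ X φ, φ ∈ sp X → ‖E X φ‖ ≤ B * (1 + D.dj X) * (nX X : ℝ) * Real.exp (-(r * D.dj X))

section families

variable {D : LocDomainSys} {Φ : Type*}

/-- LEAF (L1ᵛ) — the line stays in the analyticity domain, with an X-DEPENDENT radius `ρ X`: from every configuration of
the evaluation space `sp' X` the complexified configurations `line φ ζ`, `|ζ| < ρ X`, lie in `sp X`.  For constant `ρ`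
this is `B10Eq61PerSite.LineInDomain` (`lineInDomainVar_const`).  Hypothesis only. [cite: Balaban1987RG1, (1.11)–(1.13) p.262] -/
def LineInDomainVar (sp' sp : D.Dom → Set Φ) (line : Φ → ℂ → Φ) (ρ : D.Dom → ℝ) : Prop :=
  ∀ X φ, φ ∈ sp' X → ∀ ζ ∈ ball (0 : ℂ) (ρ X), line φ ζ ∈ sp X

/-- LEAF (L2ᵛ) — analyticity along the line on the X-dependent disc (p. 21: *"we extend them to analytic functions of
𝐔, 𝐉"*; [13] Theorem 3.4: *"extend to configurations U′U for α₁ ≤ a₁ as analytic functions of A"*).  For constant `ρ`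
this is `B10Eq61PerSite.AnalyticAlong`.  Hypothesis only. [cite: Balaban1985BackgroundPropagators, Thm 3.4 p.400] -/
def AnalyticAlongVar (sp' : D.Dom → Set Φ) (E : D.Dom → Φ → ℂ) (line : Φ → ℂ → Φ) (ρ : D.Dom → ℝ) : Prop :=
  ∀ X φ, φ ∈ sp' X → DifferentiableOn ℂ (fun ζ => E X (line φ ζ)) (ball (0 : ℂ) (ρ X))

/-- LEAF (L0) — the evaluation point `line φ 1` (= `φ` for the lines of the print) lies in the analyticity space `sp X`
(where the undifferenced bound holds).  Automatic when `ρ X > 1` (`evalInDomain_of_lineInDomainVar`); a separate,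
harmless datum when the disc is small (the evaluation spaces are the smaller ones).  Hypothesis only.
[cite: Balaban1987RG1, (1.11)–(1.13) p.262] -/
def EvalInDomain (sp' sp : D.Dom → Set Φ) (line : Φ → ℂ → Φ) : Prop :=
  ∀ X φ, φ ∈ sp' X → line φ 1 ∈ sp X

variable {sp sp' : D.Dom → Set Φ} {E : D.Dom → Φ → ℂ} {line : Φ → ℂ → Φ} {nX : D.Dom → ℕ} {B r : ℝ}

/-- Constant radius: (L1ᵛ) is `B10Eq61PerSite.LineInDomain` (definitionally). [folklore] -/
theorem lineInDomainVar_const {ρ : ℝ} :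
    LineInDomainVar sp' sp line (fun _ => ρ) ↔ B10Eq61PerSite.LineInDomain sp' sp line ρ := Iff.rfl

/-- Constant radius: (L2ᵛ) is `B10Eq61PerSite.AnalyticAlong` (definitionally). [folklore] -/
theorem analyticAlongVar_const {ρ : ℝ} :
    AnalyticAlongVar sp' E line (fun _ => ρ) ↔ B10Eq61PerSite.AnalyticAlong sp' E line ρ := Iff.rfl

/-- (L1ᵛ) is monotone: smaller discs may be booked. [folklore] -/
theorem LineInDomainVar.mono {ρ ρ' : D.Dom → ℝ} (h : LineInDomainVar sp' sp line ρ) (hle : ∀ X, ρ' X ≤ ρ X) :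
    LineInDomainVar sp' sp line ρ' :=
  fun X φ hφ ζ hζ => h X φ hφ ζ (ball_subset_ball (hle X) hζ)

/-- (L2ᵛ) is monotone. [folklore] -/
theorem AnalyticAlongVar.mono {ρ ρ' : D.Dom → ℝ} (h : AnalyticAlongVar sp' E line ρ) (hle : ∀ X, ρ' X ≤ ρ X) :
    AnalyticAlongVar sp' E line ρ' :=
  fun X φ hφ => (h X φ hφ).mono (ball_subset_ball (hle X))

/-- When every disc reaches `ζ = 1`, (L0) follows from (L1ᵛ). [folklore] -/
theorem evalInDomain_of_lineInDomainVar {ρ : D.Dom → ℝ} (h : LineInDomainVar sp' sp line ρ) (h1 : ∀ X, 1 < ρ X) :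
    EvalInDomain sp' sp line := by
  intro X φ hφ
  exact h X φ hφ 1 (by rw [mem_ball_zero_iff, norm_one]; exact h1 X)

/-- The d-linear shape converts to the per-cube shape `B13.LogHalfBound` at the cost of ONE unit of rate, by
`1 + d ≤ eᵈ` — the same arithmetic as `B13.bound118_of_logHalfBound`. [folklore] -/
theorem logHalfBound_of_lin (hB : 0 ≤ B) (h : LogHalfBoundLin D sp E nX B r) :
    B13.LogHalfBound D sp E nX B (r - 1) := by
  intro X φ hφ
  have hd : 0 ≤ D.dj X := D.dj_nonneg X
  have he : 1 + D.dj X ≤ Real.exp (D.dj X) := by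
    have := Real.add_one_le_exp (D.dj X); linarith
  have hn : (0 : ℝ) ≤ (nX X : ℝ) := Nat.cast_nonneg _
  calc ‖E X φ‖ ≤ B * (1 + D.dj X) * (nX X : ℝ) * Real.exp (-(r * D.dj X)) := h X φ hφ
    _ ≤ B * Real.exp (D.dj X) * (nX X : ℝ) * Real.exp (-(r * D.dj X)) := by
        have h1 : B * (1 + D.dj X) ≤ B * Real.exp (D.dj X) := mul_le_mul_of_nonneg_left he hB
        exact mul_le_mul_of_nonneg_right (mul_le_mul_of_nonneg_right h1 hn) (Real.exp_pos _).le
    _ = B * (nX X : ℝ) * (Real.exp (D.dj X) * Real.exp (-(r * D.dj X))) := by ring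
    _ = B * (nX X : ℝ) * Real.exp (-((r - 1) * D.dj X)) := by
        have hexp : Real.exp (D.dj X) * Real.exp (-(r * D.dj X)) = Real.exp (-((r - 1) * D.dj X)) := by
          rw [← Real.exp_add]; congr 1; ring
        rw [hexp]

/-- Conversely the per-cube shape is a d-linear shape with the same constants (`1 ≤ 1 + d`). [folklore] -/
theorem logHalfBoundLin_of_logHalfBound (hB : 0 ≤ B) (h : B13.LogHalfBound D sp E nX B r) :
    LogHalfBoundLin D sp E nX B r := by
  intro X φ hφ
  have hd : 0 ≤ D.dj X := D.dj_nonneg X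
  have hn : (0 : ℝ) ≤ (nX X : ℝ) := Nat.cast_nonneg _
  calc ‖E X φ‖ ≤ B * (nX X : ℝ) * Real.exp (-(r * D.dj X)) := h X φ hφ
    _ = B * 1 * (nX X : ℝ) * Real.exp (-(r * D.dj X)) := by ring
    _ ≤ B * (1 + D.dj X) * (nX X : ℝ) * Real.exp (-(r * D.dj X)) := by
        have h1 : B * 1 ≤ B * (1 + D.dj X) := mul_le_mul_of_nonneg_left (by linarith) hB
        exact mul_le_mul_of_nonneg_right (mul_le_mul_of_nonneg_right h1 hn) (Real.exp_pos _).le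

/-- **THE SUBTRACTION WITH AN X-DEPENDENT RADIUS COSTS `4(1 + d_{k+1}(X))/ρ₀`.**  If the undifferenced localized family
obeys `B13.LogHalfBound D sp E nX B r` on the analyticity spaces `sp`, the evaluation points lie in `sp` (L0), and from
the evaluation spaces `sp'` the complex lines stay in `sp` (L1ᵛ) with the terms holomorphic along them (L2ᵛ) on discs
of radius `ρ X ≥ ρ₀/(1 + d_{k+1}(X))`, `ρ₀ > 0` — NO lower bound `ρ X > 1` — then the differenced family
`B10Eq61PerSite.diffAlong E line` obeys the d-linear shape on `sp'` with constant `(4/ρ₀)·B` and the same rate.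
Kernel: `norm_sub_le_four_div` applied to `ζ ↦ E X (line φ ζ)`. [cite: Balaban1988RG2Cluster, p.21 (closing paragraph)] -/
theorem logHalfBoundLin_diffAlong {ρ₀ : ℝ} {ρ : D.Dom → ℝ} (hρ₀ : 0 < ρ₀) (hρ : ∀ X, ρ₀ / (1 + D.dj X) ≤ ρ X)
    (hdom : LineInDomainVar sp' sp line ρ) (hev : EvalInDomain sp' sp line) (han : AnalyticAlongVar sp' E line ρ)
    (hB : 0 ≤ B) (hE : B13.LogHalfBound D sp E nX B r) :
    LogHalfBoundLin D sp' (B10Eq61PerSite.diffAlong E line) nX (4 / ρ₀ * B) r := by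
  intro X φ hφ
  have hd : 0 ≤ D.dj X := D.dj_nonneg X
  have h1d : 0 < 1 + D.dj X := by linarith
  have hρX0 : 0 < ρ₀ / (1 + D.dj X) := div_pos hρ₀ h1d
  have hρX : 0 < ρ X := lt_of_lt_of_le hρX0 (hρ X)
  have hK : ∀ ζ ∈ ball (0 : ℂ) (ρ X), ‖E X (line φ ζ)‖ ≤ B * (nX X : ℝ) * Real.exp (-(r * D.dj X)) :=
    fun ζ hζ => hE X (line φ ζ) (hdom X φ hφ ζ hζ)
  have h1 : ‖E X (line φ 1)‖ ≤ B * (nX X : ℝ) * Real.exp (-(r * D.dj X)) := hE X (line φ 1) (hev X φ hφ)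
  have hK0 : 0 ≤ B * (nX X : ℝ) * Real.exp (-(r * D.dj X)) := by positivity
  have hdiv : 4 / ρ X ≤ 4 * (1 + D.dj X) / ρ₀ := by
    calc 4 / ρ X ≤ 4 / (ρ₀ / (1 + D.dj X)) := div_le_div_of_nonneg_left (by norm_num) hρX0 (hρ X)
      _ = 4 * (1 + D.dj X) / ρ₀ := by rw [div_div_eq_mul_div]
  calc ‖B10Eq61PerSite.diffAlong E line X φ‖ = ‖E X (line φ 1) - E X (line φ 0)‖ := rfl
    _ ≤ 4 / ρ X * (B * (nX X : ℝ) * Real.exp (-(r * D.dj X))) :=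
        norm_sub_le_four_div (f := fun ζ => E X (line φ ζ)) hρX (han X φ hφ) hK h1
    _ ≤ 4 * (1 + D.dj X) / ρ₀ * (B * (nX X : ℝ) * Real.exp (-(r * D.dj X))) :=
        mul_le_mul_of_nonneg_right hdiv hK0
    _ = 4 / ρ₀ * B * (1 + D.dj X) * (nX X : ℝ) * Real.exp (-(r * D.dj X)) := by ring

/-- **(I.1.18) for the differenced half, X-dependent radius**: with the volume bound `B13.VolBoundK1 D nX c₁`
(`nX ≤ c₁(1 + d)`), the differenced family obeys `B13.Bound118` on `sp'` with constant `(4/ρ₀)·B·c₁` and rate `r − 2`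
— one unit of rate for the cube count (as in `B13.bound118_of_logHalfBound`) and ONE MORE for the growth of the
potential of a single gauge over the dependence set.  With the printed rate `r = δ₀M` this asks `δ₀M ≥ κ + 2` where
p. 21 prints *"δ₀M ≥ κ"* and `B13.Consts.R24sharp` asked `κ + 1` — the same place in the admissible order
("M sufficiently large"). [cite: Balaban1988RG2Cluster, p.21 (closing paragraph)] -/
theorem bound118_diffAlong_var {ρ₀ c₁ : ℝ} {ρ : D.Dom → ℝ} (hρ₀ : 0 < ρ₀) (hρ : ∀ X, ρ₀ / (1 + D.dj X) ≤ ρ X)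
    (hdom : LineInDomainVar sp' sp line ρ) (hev : EvalInDomain sp' sp line) (han : AnalyticAlongVar sp' E line ρ)
    (hB : 0 ≤ B) (hE : B13.LogHalfBound D sp E nX B r) (hvol : B13.VolBoundK1 D nX c₁) :
    B13.Bound118 D sp' (B10Eq61PerSite.diffAlong E line) (4 / ρ₀ * B * c₁) (r - 2) := by
  have hlin := logHalfBoundLin_diffAlong hρ₀ hρ hdom hev han hB hE
  have hB' : 0 ≤ 4 / ρ₀ * B := by positivity
  have h := B13.bound118_of_logHalfBound D sp' (B10Eq61PerSite.diffAlong E line) nX hB'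
    (logHalfBound_of_lin hB' hlin) hvol
  have hr : r - 1 - 1 = r - 2 := by ring
  rw [hr] at h
  exact h

/-- Constant radius, any size: the shape of `B10Eq61PerSite.logHalfBound_diffAlong` with `4/ρ` for `2/ρ` and the
hypothesis `ρ > 1` replaced by (L0). [folklore] -/
theorem logHalfBound_diffAlong_anyRadius {ρ : ℝ} (hρ : 0 < ρ) (hdom : B10Eq61PerSite.LineInDomain sp' sp line ρ)
    (hev : EvalInDomain sp' sp line) (han : B10Eq61PerSite.AnalyticAlong sp' E line ρ)
    (hE : B13.LogHalfBound D sp E nX B r) :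
    B13.LogHalfBound D sp' (B10Eq61PerSite.diffAlong E line) nX (4 / ρ * B) r := by
  intro X φ hφ
  have hK : ∀ ζ ∈ ball (0 : ℂ) ρ, ‖E X (line φ ζ)‖ ≤ B * (nX X : ℝ) * Real.exp (-(r * D.dj X)) :=
    fun ζ hζ => hE X (line φ ζ) (hdom X φ hφ ζ hζ)
  have h1 : ‖E X (line φ 1)‖ ≤ B * (nX X : ℝ) * Real.exp (-(r * D.dj X)) := hE X (line φ 1) (hev X φ hφ)
  calc ‖B10Eq61PerSite.diffAlong E line X φ‖ = ‖E X (line φ 1) - E X (line φ 0)‖ := rfl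
    _ ≤ 4 / ρ * (B * (nX X : ℝ) * Real.exp (-(r * D.dj X))) :=
        norm_sub_le_four_div (f := fun ζ => E X (line φ ζ)) hρ (han X φ hφ) hK h1
    _ = 4 / ρ * B * (nX X : ℝ) * Real.exp (-(r * D.dj X)) := by ring

end families

/-! ## §3. What "absolute" costs: the exponent of (LM) in the restriction on α₀ -/

namespace Consts

/-- NOT PRINTED as such (the printed restriction is `B13.Consts.R21`, exponent 4, p. 20: *"(LM)⁴α₀ … bounded by a
constant independent of M, for example by 1"*): the restriction of the same TYPE with a general exponent `p` and bound
`κ`, `(LM)ᵖ·α₀ ≤ κ`.  `R21pow c 4 1` is the first clause of `R21` (`r21pow_four_of_R21`); exponent 5 is what reading (a)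
of p. 21's "absolute constant" consumes in the bookkeeping of this module (`bound118_absolute_of_pow5`).  Same place in
the admissible order of constants (α₀ after L, M: [Balaban1987RG1] Theorem 3, *"The constants ε₀, ε₁, α₀, α₁ depend on
M"*). [cite: Balaban1988RG2Cluster, p.20 (before the definition of C₃)] -/
def R21pow (c : B13.Consts) (p : ℕ) (κ : ℝ) : Prop := ((c.L : ℝ) * c.M) ^ p * c.α₀ ≤ κ

/-- The printed R21 contains `R21pow 4 1`. [cite: Balaban1988RG2Cluster, p.20 (before the definition of C₃)] -/
theorem r21pow_four_of_R21 (c : B13.Consts) (h : c.R21) : R21pow c 4 1 := h.1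

/-- A higher exponent implies a lower one once `LM ≥ 1` (monotonicity of the family of restrictions). [folklore] -/
theorem r21pow_mono (c : B13.Consts) {p q : ℕ} {κ : ℝ} (hLM : 1 ≤ (c.L : ℝ) * c.M) (hα₀ : 0 ≤ c.α₀) (hpq : p ≤ q)
    (h : R21pow c q κ) : R21pow c p κ := by
  unfold R21pow at h ⊢
  have hpow : ((c.L : ℝ) * c.M) ^ p ≤ ((c.L : ℝ) * c.M) ^ q := pow_le_pow_right₀ hLM hpq
  exact le_trans (mul_le_mul_of_nonneg_right hpow hα₀) h

end Consts

section arithmetic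

/-- **Base radius of the located form, exponent 5.**  If the base radius is `ρ₀ = a/(V·B′·α₀)` — `V = LM`, `a` = a
threshold of [13] of potential type (Theorem 3.1: *"(3.35) with Mα₀ ≤ a₀"*; Theorem 3.4: *"α₁ ≤ a₁"*), `B′` = the O(1)·B
of the potential bound (1.12) *"|A| < O(1)LMBα₀"* — then the restriction `V⁵·B′·α₀ ≤ K·a` gives `V⁴ ≤ K·ρ₀`, the
hypothesis of `bound118_absolute_of_radius`.  Real arithmetic. [folklore] -/
theorem radius_of_pow5 {V B' α₀ a K : ℝ} (hV : 0 < V) (hB' : 0 < B') (hα₀ : 0 < α₀)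
    (h5 : V ^ 5 * B' * α₀ ≤ K * a) : V ^ 4 ≤ K * (a / (V * B' * α₀)) := by
  have hden : 0 < V * B' * α₀ := by positivity
  rw [mul_div_assoc', le_div_iff₀ hden]
  calc V ^ 4 * (V * B' * α₀) = V ^ 5 * B' * α₀ := by ring
    _ ≤ K * a := h5

/-- **Base radius of the located form, printed exponent 4.**  Under the printed `V⁴·α₀ ≤ 1` (`B13.Consts.R21`) the same
base radius only gives `V⁴ ≤ (V·B′/a)·ρ₀` — the factor `K = V·B′/a` carries ONE power of `V = LM`. [folklore] -/
theorem radius_of_R21 {V B' α₀ a : ℝ} (hV : 0 < V) (hB' : 0 < B') (hα₀ : 0 < α₀) (ha : 0 < a)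
    (h4 : V ^ 4 * α₀ ≤ 1) : V ^ 4 ≤ (V * B' / a) * (a / (V * B' * α₀)) := by
  have hden : 0 < V * B' * α₀ := by positivity
  have heq : (V * B' / a) * (a / (V * B' * α₀)) = 1 / α₀ := by
    field_simp
  rw [heq, le_div_iff₀ hα₀]
  exact h4

variable {D : LocDomainSys} {Φ : Type*} {sp sp' : D.Dom → Set Φ} {E : D.Dom → Φ → ℂ} {line : Φ → ℂ → Φ}
  {nX : D.Dom → ℕ}

/-- **Reading (a) as bookkeeping on the radius.**  Undifferenced per-cube constant `A·(LM)⁴` (O(1) per site — all that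
the volume bounds (44)–(46) of [16] assert), X-dependent radii `ρ X ≥ ρ₀/(1 + d_{k+1}(X))` with a base radius
dominating the cube volume, `(LM)⁴ ≤ K·ρ₀` ⇒ (I.1.18) for the differenced half on the evaluation spaces with the
constant `4K·A·c₁` — ABSOLUTE iff `K`, `A`, `c₁` are — and rate `r − 2`.  Which `K` print affords is §3's pair
`radius_of_pow5` (absolute `K`, unprinted exponent 5) / `radius_of_R21` (`K = LM·B′/a`, printed exponent 4).
[cite: Balaban1988RG2Cluster, pp.20–21 (R21 and the closing paragraph)] -/
theorem bound118_absolute_of_radius (c : B13.Consts) {A K ρ₀ r c₁ : ℝ} {ρ : D.Dom → ℝ} (hA : 0 ≤ A) (hK : 0 ≤ K)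
    (hc₁ : 0 ≤ c₁) (hρ₀ : 0 < ρ₀) (hKρ : ((c.L : ℝ) * c.M) ^ 4 ≤ K * ρ₀) (hρ : ∀ X, ρ₀ / (1 + D.dj X) ≤ ρ X)
    (hdom : LineInDomainVar sp' sp line ρ) (hev : EvalInDomain sp' sp line) (han : AnalyticAlongVar sp' E line ρ)
    (hE : B13.LogHalfBound D sp E nX (A * ((c.L : ℝ) * c.M) ^ 4) r) (hvol : B13.VolBoundK1 D nX c₁) :
    B13.Bound118 D sp' (B10Eq61PerSite.diffAlong E line) (4 * K * A * c₁) (r - 2) := by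
  have hB : 0 ≤ A * ((c.L : ℝ) * c.M) ^ 4 := by positivity
  have h := bound118_diffAlong_var hρ₀ hρ hdom hev han hB hE hvol
  have h1 : ((c.L : ℝ) * c.M) ^ 4 / ρ₀ ≤ K := by rw [div_le_iff₀ hρ₀]; exact hKρ
  have hAc : 0 ≤ 4 * A * c₁ := by positivity
  have hle : 4 / ρ₀ * (A * ((c.L : ℝ) * c.M) ^ 4) * c₁ ≤ 4 * K * A * c₁ := by
    have h2 : 4 / ρ₀ * (A * ((c.L : ℝ) * c.M) ^ 4) * c₁ = ((c.L : ℝ) * c.M) ^ 4 / ρ₀ * (4 * A * c₁) := by ring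
    have h3 : 4 * K * A * c₁ = K * (4 * A * c₁) := by ring
    rw [h2, h3]
    exact mul_le_mul_of_nonneg_right h1 hAc
  exact B13.bound118_mono D sp' (B10Eq61PerSite.diffAlong E line) hle le_rfl (by positivity) h

/-- **Reading (a) under the UNPRINTED exponent 5.**  Base radius `ρ₀ = a/(LM·B′·α₀)` of the located form and the
restriction `(LM)⁵·B′·α₀ ≤ K·a` (`Consts.R21pow c 5 (K·a/B′)` up to the placement of `B′`) ⇒ (I.1.18) for the
differenced half with the constant `4K·A·c₁` and rate `r − 2`: p. 21's *"absolute constant"* in reading (a), reached in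
the admissible order of constants at the price of an exponent print does not state.  Nothing printed is asserted; the
dictionary behind `ρ₀` is the cell's GAPS record, not a theorem. [cite: Balaban1988RG2Cluster, pp.20–21 (R21 and the closing paragraph)] -/
theorem bound118_absolute_of_pow5 (c : B13.Consts) {A B' a K r c₁ : ℝ} {ρ : D.Dom → ℝ}
    (hLM : 0 < (c.L : ℝ) * c.M) (hα₀ : 0 < c.α₀) (hA : 0 ≤ A) (hB' : 0 < B') (ha : 0 < a) (hK : 0 ≤ K)
    (hc₁ : 0 ≤ c₁) (h5 : ((c.L : ℝ) * c.M) ^ 5 * B' * c.α₀ ≤ K * a)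
    (hρ : ∀ X, a / ((c.L : ℝ) * c.M * B' * c.α₀) / (1 + D.dj X) ≤ ρ X)
    (hdom : LineInDomainVar sp' sp line ρ) (hev : EvalInDomain sp' sp line) (han : AnalyticAlongVar sp' E line ρ)
    (hE : B13.LogHalfBound D sp E nX (A * ((c.L : ℝ) * c.M) ^ 4) r) (hvol : B13.VolBoundK1 D nX c₁) :
    B13.Bound118 D sp' (B10Eq61PerSite.diffAlong E line) (4 * K * A * c₁) (r - 2) :=
  bound118_absolute_of_radius c hA hK hc₁ (div_pos ha (mul_pos (mul_pos hLM hB') hα₀))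
    (radius_of_pow5 hLM hB' hα₀ h5) hρ hdom hev han hE hvol

/-- **The printed exponent 4 alone: one power of LM short.**  With the same base radius and only the printed
`(LM)⁴α₀ ≤ 1` (first clause of `B13.Consts.R21`) the constant is `4·(LM·B′/a)·A·c₁` — reading (b) improved from `(LM)⁴`
to `(LM)¹`, not absolute. [cite: Balaban1988RG2Cluster, pp.20–21 (R21 and the closing paragraph)] -/
theorem bound118_of_R21_radius (c : B13.Consts) {A B' a r c₁ : ℝ} {ρ : D.Dom → ℝ}
    (hLM : 0 < (c.L : ℝ) * c.M) (hα₀ : 0 < c.α₀) (hA : 0 ≤ A) (hB' : 0 < B') (ha : 0 < a) (hc₁ : 0 ≤ c₁)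
    (h21 : c.R21) (hρ : ∀ X, a / ((c.L : ℝ) * c.M * B' * c.α₀) / (1 + D.dj X) ≤ ρ X)
    (hdom : LineInDomainVar sp' sp line ρ) (hev : EvalInDomain sp' sp line) (han : AnalyticAlongVar sp' E line ρ)
    (hE : B13.LogHalfBound D sp E nX (A * ((c.L : ℝ) * c.M) ^ 4) r) (hvol : B13.VolBoundK1 D nX c₁) :
    B13.Bound118 D sp' (B10Eq61PerSite.diffAlong E line) (4 * ((c.L : ℝ) * c.M * B' / a) * A * c₁) (r - 2) :=
  bound118_absolute_of_radius c hA (div_nonneg (mul_nonneg hLM.le hB'.le) ha.le) hc₁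
    (div_pos ha (mul_pos (mul_pos hLM hB') hα₀)) (radius_of_R21 hLM hB' hα₀ ha h21.1) hρ hdom hev han hE hvol

end arithmetic

/-! ## §4. Non-vacuity: the leaves of §2 and the undifferenced bound are jointly satisfiable by a non-constant family -/

section examples

open B10Eq61PerSite in
/-- For the example data of `B10Eq61PerSite` §5 (configurations `ℂ`, line `ζ ↦ ζ·φ`, evaluation space the closed unit
disc, analyticity space the open disc of radius `ρ > 1`, family `(B/ρ)·φ`) the hypotheses of `logHalfBoundLin_diffAlong`
hold (constant radius, `ρ₀ = ρ`, tree length `0`) and the theorem yields the d-linear shape with constant `(4/ρ)·B` for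
a NON-ZERO differenced family — no hypothesis is `False`. [folklore] -/
example {ρ B : ℝ} (hρ : 1 < ρ) (hB : 0 ≤ B) :
    LogHalfBoundLin unitSys (fun _ => closedBall (0 : ℂ) 1)
      (diffAlong (fun _ φ => ((B / ρ : ℝ) : ℂ) * φ) (fun φ ζ => ζ * φ)) (fun _ => 1) (4 / ρ * B) 0 := by
  have hρ0 : 0 < ρ := lt_trans zero_lt_one hρ
  have hdom : LineInDomainVar (D := unitSys) (fun _ => closedBall (0 : ℂ) 1) (fun _ => ball (0 : ℂ) ρ)
      (fun φ ζ => ζ * φ) (fun _ => ρ) := lineInDomainVar_const.mpr example_lineInDomain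
  have han : AnalyticAlongVar (D := unitSys) (fun _ => closedBall (0 : ℂ) 1) (fun _ φ => ((B / ρ : ℝ) : ℂ) * φ)
      (fun φ ζ => ζ * φ) (fun _ => ρ) := analyticAlongVar_const.mpr example_analyticAlong
  have hρ' : ∀ X : unitSys.Dom, ρ / (1 + unitSys.dj X) ≤ (fun _ => ρ) X := by
    intro X
    show ρ / (1 + 0) ≤ ρ
    rw [add_zero, div_one]
  exact logHalfBoundLin_diffAlong hρ0 hρ' hdom (evalInDomain_of_lineInDomainVar hdom fun _ => hρ) han hB
    (example_logHalfBound hρ0 hB)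

end examples

end Literature.MathematicalPhysics.QuantumFieldTheory.Balaban1983to89.B13LogHalfRadius

end
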